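import Mathlib
import Literature.NumberTheory.Transcendental.GammaIsoCross
import Literature.NumberTheory.Transcendental.ZilberGenericClosedness
import Literature.NumberTheory.Transcendental.ZilberField
import Literature.NumberTheory.Transcendental.ZilberFieldQuasiminimal
import Literature.NumberTheory.Transcendental.EclPredim
import Literature.NumberTheory.Transcendental.GammaFieldsEcl
import Literature.NumberTheory.Transcendental.ZilberFieldExistenceProofs
import Literature.NumberTheory.Transcendental.ZilberClassHomogeneity

/-!
# Stub `stub_caseI` (line `eac-extends-core-automorphisms`, crux stmt-Schanuel-0968)

**Case I of the residue (A₀) of `RigidCore.AclSubsetLogFreeCore` under Zilber's conjecture**: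
granted hull-to-core (`hH2C`: a Γ-isomorphism over the identity of `ℚ^{ab}(2πi)` between strong
tuples is realised by an exponential-field automorphism of `ecl ∅`) and the doubling principle
(`hD`: a free strong extension of predimension `0` of `X = ℚ·2πi + ℚc ◁ ℂ` has a Γ-isomorphic
strong partner over `c` in general position), every element of `ecl ∅` fixed by all
exponential-field automorphisms of `ecl ∅` lies in the ELA-core: the smallest subfield of `ℂ`
containing `2πi` which is closed under `exp`, relatively algebraically closed and closed under
logarithms.

Proof (Bays–Kirby Γ-field calculus, tree files `GammaFields.lean`, `EclPredim.lean`):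
`Λ₀ = ℚ·2πi` is strong (Schanuel property of the Zilber field,
`schanuelProperty_iff_isStrong_span_kernelGenerator`); the Khovanskii tuple `x̄` witnessing
`a ∈ ecl ∅ ⊆ ecl Λ₀` spans a hull `W = Λ₀ + ℚx̄ ⊆ ecl ∅` with `δ(W/Λ₀) = 0`
(`predim_span_le_zero_of_khovanskii`), hence `W ◁ ℂ`; the E/L/A-chain closure `U*` of `Λ₀`
inside `W` (maximal `U` with `Λ₀ ≤ U ≤ W`, `U ◁ ℂ`, `δ(U/Λ₀) = 0`, `U ⊆ C_ELA`; one-element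
A- or L-steps have `δ = 0`) is closed under "algebraic over `ℚ(gens U*)`" and "logarithm of such"
inside `W`, so `W` is free over `U*`; doubling and hull-to-core give a core automorphism `g`
with `g = id` on `U*` and `g ē = ē'`, `Σ qⱼ (e'ⱼ - eⱼ) ∉ U*` for `q ≠ 0`; as `g` is `ℚ`-linear on
`ecl ∅ ⊇ W`, `g a = a` forces `a ∈ U* ⊆ C_ELA`.
-/

noncomputable section

set_option linter.dupNamespace false

open Set
open Literature.ModelTheory.ExponentialFields
open Literature.ModelTheory.ExponentialFields.ExponentialRing
open Literature.NumberTheory.Transcendental Literature.NumberTheory.Transcendental.GammaField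

namespace Summit.Schanuel.Schanuel.Theorems.RigidCore

section General

variable {F : Type} [Field F] [CharZero F] [ExponentialRing F]

/-- **Hulls inside `ecl` keeping the Khovanskii tuple**: over a strong `Λ`, an element
`d ∈ ecl Λ` is a coordinate of a finite tuple `x̄ ⊆ ecl Λ` with `δ(x̄/Λ) = 0` (the solution of
the Khovanskii system witnessing `d ∈ ecl Λ`: `δ ≤ 0` by `predim_span_le_zero_of_khovanskii`,
`δ ≥ 0` by strongness). [cite: Kirby2010, §7 (proof of Thm. 1.3)] -/
theorem exists_tuple_predim_eq_zero_of_mem_ecl {Λ : Submodule ℚ F} (hΛ : IsStrong Λ) {d : F}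
    (hd : d ∈ ecl (Λ : Set F)) :
    ∃ (n : ℕ) (x : Fin n → F), d ∈ range x ∧ (∀ i, x i ∈ ecl (Λ : Set F)) ∧
      predim Λ (Submodule.span ℚ (range x)) = 0 := by
  obtain ⟨n, x, f, ⟨i, hi⟩, hcoeff, heval, hdet⟩ := hd
  refine ⟨n, x, ⟨i, hi⟩, fun j => ⟨n, x, f, ⟨j, rfl⟩, hcoeff, heval, hdet⟩, ?_⟩
  have hδ := predim_span_le_zero_of_khovanskii Λ (fun _ hb => mem_fieldOf_of_mem hb) hcoeff heval
    hdet
  exact le_antisymm hδ ((isStrong_iff.1 hΛ) _ (isFG_span_of_finite Λ (finite_range x)))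

/-- **One-element A- or L-steps have predimension `0`**: if `U ◁ F`, `v ∉ U`, and `v` or
`exp v` is algebraic over the Γ-field `ℚ(gens U)`, then `δ(v/U) = 0`
(`td(v, exp v/U) ≤ 1 = ldim`). [folklore] -/
theorem predim_span_singleton_eq_zero_of_acl {U : Submodule ℚ F} (hU : IsStrong U) {v : F}
    (hv : v ∉ U) (hAL : v ∈ acl (gens U) ∨ exp v ∈ acl (gens U)) :
    predim U (Submodule.span ℚ {v}) = 0 := by
  have hfg : IsFG U (Submodule.span ℚ ({v} : Set F)) := isFG_span_of_finite U (finite_singleton v)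
  have h0 : 0 ≤ predim U (Submodule.span ℚ {v}) := (isStrong_iff.1 hU) _ hfg
  have htd : td U (Submodule.span ℚ {v}) ≤ 1 := by
    rw [td_span_singleton]
    rcases hAL with h | h
    · rw [pair_comm]
      calc (algMatroid F).relRank (gens U) {exp v, v}
          ≤ (algMatroid F).relRank (gens U) {v} + 1 := (algMatroid F).relRank_insert_le _ _ _
        _ = 1 := by
          rw [(algMatroid F).relRank_eq_zero_of_subset_closure (singleton_subset_iff.2 h),
            zero_add]
    · calc (algMatroid F).relRank (gens U) {v, exp v}
          ≤ (algMatroid F).relRank (gens U) {exp v} + 1 := (algMatroid F).relRank_insert_le _ _ _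
        _ = 1 := by
          rw [(algMatroid F).relRank_eq_zero_of_subset_closure (singleton_subset_iff.2 h),
            zero_add]
  have htdn : (td U (Submodule.span ℚ {v})).toNat ≤ 1 := ENat.toNat_le_of_le_coe htd
  rw [predim_def, ldim_span_singleton_of_not_mem hv] at h0 ⊢
  omega

/-- **The E/L/A-chain closure inside a finitely generated extension of a strong base.** For
`Λ₀ ◁ F`, `Λ₀ ≤ W` finitely generated, and a property `G` of subspaces holding at `Λ₀` and
preserved by adjoining to `U` (`Λ₀ ≤ U ≤ W`) an element `v ∈ W` with `v` or `exp v` algebraic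
over `ℚ(gens U)`, there is `U` with `Λ₀ ≤ U ≤ W`, `U ◁ F`, `δ(U/Λ₀) = 0`, `G U`, which is closed
inside `W` under such adjunctions (a `U` of maximal dimension among those with the first five
properties; one more step would stay admissible by `predim_span_singleton_eq_zero_of_acl` and
Bays–Kirby Lemma 4.8). [folklore] -/
theorem exists_chainClosure {Λ₀ W : Submodule ℚ F} (hΛ₀ : IsStrong Λ₀) (hW : Λ₀ ≤ W)
    (hfg : IsFG Λ₀ W) (G : Submodule ℚ F → Prop) (hG₀ : G Λ₀)
    (hGstep : ∀ U : Submodule ℚ F, Λ₀ ≤ U → U ≤ W → G U → ∀ v ∈ W,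
      (v ∈ acl (gens U) ∨ exp v ∈ acl (gens U)) → G (U ⊔ Submodule.span ℚ {v})) :
    ∃ U : Submodule ℚ F, Λ₀ ≤ U ∧ U ≤ W ∧ IsStrong U ∧ predim Λ₀ U = 0 ∧ G U ∧
      ∀ v ∈ W, (v ∈ acl (gens U) ∨ exp v ∈ acl (gens U)) → v ∈ U := by
  classical
  set S : Set (Submodule ℚ F) :=
    {U | Λ₀ ≤ U ∧ U ≤ W ∧ IsStrong U ∧ predim Λ₀ U = 0 ∧ G U} with hS
  have hS0 : Λ₀ ∈ S := ⟨le_rfl, hW, hΛ₀, predim_self Λ₀, hG₀⟩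
  obtain ⟨U, ⟨hΛ₀U, hUW, hU, hδU, hGU⟩, hmin⟩ :=
    (InvImage.wf (fun U : Submodule ℚ F => ldim Λ₀ W - ldim Λ₀ U) wellFounded_lt).has_min S
      ⟨Λ₀, hS0⟩
  refine ⟨U, hΛ₀U, hUW, hU, hδU, hGU, fun v hvW hAL => ?_⟩
  by_contra hv
  -- one more step stays in `S` and has larger dimension
  set U' : Submodule ℚ F := U ⊔ Submodule.span ℚ {v} with hU'
  have hU'W : U' ≤ W := sup_le hUW ((Submodule.span_singleton_le_iff_mem v W).2 hvW)
  have hfgv : IsFG U (Submodule.span ℚ ({v} : Set F)) := isFG_span_of_finite U (finite_singleton v)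
  have hδv : predim U (Submodule.span ℚ {v}) = 0 := predim_span_singleton_eq_zero_of_acl hU hv hAL
  have hU's : IsStrong U' :=
    hU.of_predim_eq_zero le_sup_left (isFG_sup_left.2 hfgv) (by rw [predim_sup_left]; exact hδv)
  have hfgU' : IsFG Λ₀ U' := hfg.mono hU'W
  have hδU' : predim Λ₀ U' = 0 := by
    rw [predim_add hΛ₀U le_sup_left hfgU', hδU, predim_sup_left, hδv]; rfl
  have hU'S : U' ∈ S := ⟨hΛ₀U.trans le_sup_left, hU'W, hU's, hδU', hGstep U hΛ₀U hUW hGU v hvW hAL⟩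
  have hdim : ldim Λ₀ U' = ldim Λ₀ U + 1 := by
    rw [ldim_add hΛ₀U le_sup_left hfgU', ldim_sup_left, ldim_span_singleton_of_not_mem hv]
  have hle : ldim Λ₀ U' ≤ ldim Λ₀ W := ldim_mono hfg hU'W
  have := hmin U' hU'S
  simp only [InvImage] at this
  omega

end General

/-! ### Case I -/

/-- **Case I: core-fixed elements are ELA (doubling ⟹ genericity).**  Under Zilber's
conjecture for `ℂ_exp`, granted hull-to-core (`hH2C`) and the doubling principle (`hD`), every
element of `ecl ∅` fixed by all exponential-field automorphisms of `C₀ = ecl ∅` lies in the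
ELA-core `C_ELA`, the smallest subfield of `ℂ` containing `2πi` which is closed under `exp`,
relatively algebraically closed, and closed under logarithms.  Proof: Schanuel
(`hZ.schanuelProperty`, `schanuelProperty_iff_isStrong_span_kernelGenerator`) makes `Λ₀ = ℚ·2πi`
strong; the Khovanskii tuple `x̄ ⊆ ecl ∅` of `a` spans a hull `W = Λ₀ + ℚx̄ ◁ ℂ` with
`δ(W/Λ₀) = 0` (`exists_tuple_predim_eq_zero_of_mem_ecl`); the E/L/A-chain closure `U*` of `Λ₀`
inside `W` (`exists_chainClosure`) is strong, has `δ(W/U*) = 0`, lies in `C_ELA` (closure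
properties of `C_ELA`), and `W` is free over it; writing `U* = ℚc̄` (`c₀ = 2πi`) and
`W = U* ⊕ ℚē`, `hD` gives a Γ-isomorphic strong partner `ē'` with `Σ qⱼ(e'ⱼ - eⱼ) ∉ U*` for
`q ≠ 0`, `hH2C` a core automorphism `g` with `g c̄ = c̄`, `g ē = ē'`; `g` is `ℚ`-linear on
`ecl ∅ ⊇ W`, so for `a = u + Σ qⱼ eⱼ` the fixed-point hypothesis `g a = a` forces `q = 0`, i.e.
`a ∈ U* ⊆ C_ELA`. [cite: BaysKirby2018ANT, Lemma 4.8 and Def. 4.6]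
[cite: Kirby2010, §7 (proof of Thm. 1.3)] -/
theorem stub_caseI (hZ : IsZilberField ℂ) (τ : ℂ) (hτ : τ = 2 * ↑Real.pi * Complex.I)
    (hH2C : ∀ {N : ℕ} {c c' : Fin N → ℂ},
      IsGammaIsoTw₂ (RingEquiv.refl (fieldOf (Submodule.span ℚ ({τ} : Set ℂ)))) c c' →
      IsStrong (Submodule.span ℚ ({τ} : Set ℂ) ⊔ Submodule.span ℚ (range c)) →
      IsStrong (Submodule.span ℚ ({τ} : Set ℂ) ⊔ Submodule.span ℚ (range c')) →
      ∃ g : ℂ → ℂ, IsEIsoOn g (ecl (∅ : Set ℂ)) (ecl (∅ : Set ℂ)) ∧ ∀ j, g (c j) = c' j)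
    (hD : ∀ {N k : ℕ} (c : Fin N → ℂ) (e : Fin k → ℂ),
      IsStrong (Submodule.span ℚ ({τ} : Set ℂ) ⊔ Submodule.span ℚ (range c)) →
      IsStrong (Submodule.span ℚ ({τ} : Set ℂ) ⊔
        Submodule.span ℚ (range (Fin.append c e))) →
      LinIndepOver (Submodule.span ℚ ({τ} : Set ℂ) ⊔ Submodule.span ℚ (range c)) e →
      predim (Submodule.span ℚ ({τ} : Set ℂ) ⊔ Submodule.span ℚ (range c))
        (Submodule.span ℚ (range e)) = 0 →
      (∀ m : Fin k → ℤ, m ≠ 0 →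
        (∑ j, (m j : ℚ) • e j) ∉ acl (gens (Submodule.span ℚ ({τ} : Set ℂ) ⊔
          Submodule.span ℚ (range c))) ∧
        Complex.exp (∑ j, (m j : ℚ) • e j) ∉ acl (gens (Submodule.span ℚ ({τ} : Set ℂ) ⊔
          Submodule.span ℚ (range c)))) →
      ∃ e' : Fin k → ℂ,
        IsGammaIsoTw₂ (RingEquiv.refl (fieldOf (Submodule.span ℚ ({τ} : Set ℂ))))
          (Fin.append c e) (Fin.append c e') ∧
        IsStrong (Submodule.span ℚ ({τ} : Set ℂ) ⊔
          Submodule.span ℚ (range (Fin.append c e'))) ∧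
        ∀ q : Fin k → ℚ, q ≠ 0 →
          (∑ j, q j • (e' j - e j)) ∉
            Submodule.span ℚ ({τ} : Set ℂ) ⊔ Submodule.span ℚ (range c)) :
    ∀ a ∈ ecl (∅ : Set ℂ),
      (∀ g : ℂ → ℂ, IsEIsoOn g (ecl (∅ : Set ℂ)) (ecl (∅ : Set ℂ)) → g a = a) →
        a ∈ (sInf {K : IntermediateField ℚ ℂ | (2 * ↑Real.pi * Complex.I : ℂ) ∈ K ∧
          (∀ w ∈ K, Complex.exp w ∈ K) ∧ (∀ w : ℂ, IsAlgebraic K w → w ∈ K) ∧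
          (∀ w : ℂ, Complex.exp w ∈ K → w ∈ K)} : IntermediateField ℚ ℂ) := by
  classical
  intro a ha hfix
  -- abstract the family of E/L/A-closed subfields containing `τ`
  suffices H : ∀ 𝒦 : Set (IntermediateField ℚ ℂ),
      (∀ K ∈ 𝒦, τ ∈ K ∧ (∀ w ∈ K, Complex.exp w ∈ K) ∧ (∀ w : ℂ, IsAlgebraic K w → w ∈ K) ∧
        (∀ w : ℂ, Complex.exp w ∈ K → w ∈ K)) → a ∈ sInf 𝒦 by
    exact H _ fun K hK => ⟨by rw [hτ]; exact hK.1, hK.2⟩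
  intro 𝒦 h𝒦
  /- (0) `τ` is a transcendental kernel generator, so Schanuel makes `Λ₀ = ℚτ` strong -/
  have hexpτ : Complex.exp τ = 1 := by rw [hτ]; exact Complex.exp_two_pi_mul_I
  have htrans : Transcendental ℚ τ := by
    obtain ⟨τ₀, hτ₀, hker⟩ := hZ.hasStandardKernel
    have hτ₀mem : τ₀ ∈ expKernel ℂ := by rw [hker]; exact AddSubgroup.mem_zmultiples τ₀
    obtain ⟨m, hm⟩ := (mem_expKernel_complex_iff τ₀).1 hτ₀mem
    rw [← hτ] at hm
    intro halg
    exact hτ₀ (by rw [hm]; exact (isAlgebraic_int m).mul halg)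
  have hΛ₀ : IsStrong (Submodule.span ℚ ({τ} : Set ℂ)) :=
    (schanuelProperty_iff_isStrong_span_kernelGenerator htrans hexpτ).1 hZ.schanuelProperty
  -- `Λ₀ ⊆ ecl ∅`, hence `ecl Λ₀ = ecl ∅`
  have hτecl : τ ∈ ecl (∅ : Set ℂ) :=
    expKernel_subset_ecl (∅ : Set ℂ) ((mem_expKernel_iff τ).2 hexpτ)
  have hΛ₀ecl : ((Submodule.span ℚ ({τ} : Set ℂ) : Submodule ℚ ℂ) : Set ℂ) ⊆ ecl (∅ : Set ℂ) := by
    intro z hz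
    obtain ⟨q, rfl⟩ := Submodule.mem_span_singleton.1 hz
    exact smul_mem_ecl q hτecl
  have heclΛ₀ : ecl ((Submodule.span ℚ ({τ} : Set ℂ) : Submodule ℚ ℂ) : Set ℂ) =
      ecl (∅ : Set ℂ) := by
    apply Subset.antisymm
    · have h := ecl_mono hΛ₀ecl
      rwa [Khovanskii.ecl_ecl] at h
    · exact ecl_mono (empty_subset _)
  /- (1) the hull `W = Λ₀ + ℚx̄ ◁ ℂ` of `a`, `δ(W/Λ₀) = 0`, `W ⊆ ecl ∅` -/
  have ha' : a ∈ ecl ((Submodule.span ℚ ({τ} : Set ℂ) : Submodule ℚ ℂ) : Set ℂ) := by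
    rw [heclΛ₀]; exact ha
  obtain ⟨n, x, hax, hxecl, hδx⟩ := exists_tuple_predim_eq_zero_of_mem_ecl hΛ₀ ha'
  obtain ⟨W, hWdef⟩ : ∃ W : Submodule ℚ ℂ,
      W = Submodule.span ℚ ({τ} : Set ℂ) ⊔ Submodule.span ℚ (range x) := ⟨_, rfl⟩
  have hΛ₀W : Submodule.span ℚ ({τ} : Set ℂ) ≤ W := hWdef ▸ le_sup_left
  have hxW : Submodule.span ℚ (range x) ≤ W := hWdef ▸ le_sup_right
  have hfgW : IsFG (Submodule.span ℚ ({τ} : Set ℂ)) W := by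
    rw [hWdef, isFG_sup_left]; exact isFG_span_of_finite _ (finite_range x)
  have hδW : predim (Submodule.span ℚ ({τ} : Set ℂ)) W = 0 := by
    rw [hWdef, predim_sup_left]; exact hδx
  have hWs : IsStrong W := hΛ₀.of_predim_eq_zero hΛ₀W hfgW hδW
  have hWecl : ∀ w ∈ W, w ∈ ecl (∅ : Set ℂ) := by
    have hle : W ≤ Submodule.span ℚ (ecl (∅ : Set ℂ)) := by
      rw [hWdef]
      exact sup_le (Submodule.span_le.2 (singleton_subset_iff.2 (Submodule.subset_span hτecl)))
        (Submodule.span_le.2 (range_subset_iff.2 fun i =>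
          Submodule.subset_span (heclΛ₀ ▸ hxecl i)))
    intro w hw
    exact mem_span_ecl_iff.1 (hle hw)
  have haW : a ∈ W := hxW (Submodule.subset_span hax)
  /- (2) the E/L/A-chain closure `U` of `Λ₀` inside `W`, contained in every `K ∈ 𝒦` -/
  have hG₀ : ∀ K ∈ 𝒦, Submodule.span ℚ ({τ} : Set ℂ) ≤ Subalgebra.toSubmodule K.toSubalgebra :=
    fun K hK => (Submodule.span_singleton_le_iff_mem _ _).2 (h𝒦 K hK).1
  have hGstep : ∀ U : Submodule ℚ ℂ, Submodule.span ℚ ({τ} : Set ℂ) ≤ U → U ≤ W →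
      (∀ K ∈ 𝒦, U ≤ Subalgebra.toSubmodule K.toSubalgebra) → ∀ v ∈ W,
      (v ∈ acl (gens U) ∨ exp v ∈ acl (gens U)) →
      ∀ K ∈ 𝒦, U ⊔ Submodule.span ℚ {v} ≤ Subalgebra.toSubmodule K.toSubalgebra := by
    intro U _ _ hGU v _ hAL K hK
    have hUK : U ≤ Subalgebra.toSubmodule K.toSubalgebra := hGU K hK
    obtain ⟨-, hKexp, hKalg, hKlog⟩ := h𝒦 K hK
    have hgensK : gens U ⊆ (K : Set ℂ) := by
      rintro z (hz | ⟨y, hy, rfl⟩)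
      · exact hUK hz
      · exact hKexp y (hUK hy)
    have haclK : acl (gens U) ⊆ (K : Set ℂ) := by
      intro z hz
      have hz' : z ∈ acl ((K : Set ℂ)) := acl_mono hgensK hz
      have hadj : Algebra.adjoin ℚ (K : Set ℂ) = K.toSubalgebra := Algebra.adjoin_eq K.toSubalgebra
      rw [mem_acl_iff, hadj] at hz'
      exact hKalg z hz'
    have hvK : v ∈ K := by
      rcases hAL with h | h
      · exact haclK h
      · exact hKlog v (haclK h)
    exact sup_le hUK ((Submodule.span_singleton_le_iff_mem _ _).2 hvK)
  obtain ⟨U, hΛ₀U, hUW, hUs, hδU, hGU, hclosed⟩ :=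
    exists_chainClosure hΛ₀ hΛ₀W hfgW
      (fun U => ∀ K ∈ 𝒦, U ≤ Subalgebra.toSubmodule K.toSubalgebra) hG₀ hGstep
  have hδUW : predim U W = 0 := by
    have h := predim_add hΛ₀U hUW hfgW
    rw [hδW, hδU] at h
    omega
  /- (3) generators: `U = ℚc̄` with `c₀ = τ`, and a basis `ē` of `W` modulo `U` -/
  obtain ⟨s, hsU, hUle⟩ := isFG_iff_exists_finset.1 (hfgW.mono hUW)
  set c : Fin (s.card + 1) → ℂ :=
    Fin.cons τ (fun i : Fin s.card => ((s.equivFin.symm i : s) : ℂ)) with hcdef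
  have hc0 : c 0 = τ := by simp [hcdef]
  have hcU : ∀ i, c i ∈ U := by
    intro i
    refine Fin.cases ?_ (fun j => ?_) i
    · rw [hc0]; exact hΛ₀U (Submodule.mem_span_singleton_self τ)
    · simp only [hcdef, Fin.cons_succ]
      exact hsU (s.equivFin.symm j).2
  have hXU : Submodule.span ℚ ({τ} : Set ℂ) ⊔ Submodule.span ℚ (range c) = U := by
    apply le_antisymm
    · exact sup_le hΛ₀U (Submodule.span_le.2 (range_subset_iff.2 hcU))
    · refine hUle.trans (sup_le le_sup_left
        ((Submodule.span_mono fun y hy => ?_).trans le_sup_right))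
      exact ⟨Fin.succ (s.equivFin ⟨y, hy⟩), by simp [hcdef]⟩
  have hUc : U ≤ Submodule.span ℚ (range c) := by
    rw [← hXU]
    exact sup_le (Submodule.span_mono (singleton_subset_iff.2 ⟨0, hc0⟩)) le_rfl
  obtain ⟨k, ρ, hlin, hspan⟩ := ZilberSaturationMain.exists_linIndepOver_comp U x
  set e : Fin k → ℂ := x ∘ ρ with hedef
  have hUe : U ⊔ Submodule.span ℚ (range e) = W := by
    rw [hspan]
    exact le_antisymm (sup_le hUW hxW) (hWdef ▸ sup_le (hΛ₀U.trans le_sup_left) le_sup_right)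
  have heW : ∀ j, e j ∈ W := fun j =>
    hUe ▸ Submodule.mem_sup_right (Submodule.subset_span ⟨j, rfl⟩)
  have hδe : predim U (Submodule.span ℚ (range e)) = 0 := by
    rw [← predim_sup_left, hUe]; exact hδUW
  -- the hypotheses of the doubling principle for `(c, e)`
  have hXs : IsStrong (Submodule.span ℚ ({τ} : Set ℂ) ⊔ Submodule.span ℚ (range c)) := by
    rw [hXU]; exact hUs
  have hXW : Submodule.span ℚ ({τ} : Set ℂ) ⊔ Submodule.span ℚ (range c) ⊔
      Submodule.span ℚ (range (Fin.append c e)) = W := by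
    rw [ZilberHomogeneity.range_append, Submodule.span_union, ← sup_assoc,
      sup_eq_left.2 (le_sup_right : Submodule.span ℚ (range c) ≤
        Submodule.span ℚ ({τ} : Set ℂ) ⊔ Submodule.span ℚ (range c)), hXU, hUe]
  have hXes : IsStrong (Submodule.span ℚ ({τ} : Set ℂ) ⊔
      Submodule.span ℚ (range (Fin.append c e))) := by
    have h : Submodule.span ℚ ({τ} : Set ℂ) ⊔ Submodule.span ℚ (range (Fin.append c e)) = W := by
      apply le_antisymm
      · rw [← hXW]; exact sup_le_sup_right le_sup_left _
      · rw [← hUe, ← hXU, ZilberHomogeneity.range_append, Submodule.span_union]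
        exact sup_le (sup_le_sup_left le_sup_left _) (le_sup_right.trans le_sup_right)
    rw [h]; exact hWs
  have hXlin : LinIndepOver (Submodule.span ℚ ({τ} : Set ℂ) ⊔ Submodule.span ℚ (range c)) e := by
    rw [hXU]; exact hlin
  have hXδ : predim (Submodule.span ℚ ({τ} : Set ℂ) ⊔ Submodule.span ℚ (range c))
      (Submodule.span ℚ (range e)) = 0 := by
    rw [hXU]; exact hδe
  have hfree : ∀ m : Fin k → ℤ, m ≠ 0 →
      (∑ j, (m j : ℚ) • e j) ∉ acl (gens (Submodule.span ℚ ({τ} : Set ℂ) ⊔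
        Submodule.span ℚ (range c))) ∧
      Complex.exp (∑ j, (m j : ℚ) • e j) ∉ acl (gens (Submodule.span ℚ ({τ} : Set ℂ) ⊔
        Submodule.span ℚ (range c))) := by
    intro m hm
    have hvW : (∑ j, (m j : ℚ) • e j) ∈ W := W.sum_mem fun j _ => W.smul_mem _ (heW j)
    have hvU : (∑ j, (m j : ℚ) • e j) ∉ U := fun h => hm (by
      funext j
      have hj := congrFun (hlin (fun j => (m j : ℚ)) h) j
      simp only [Pi.zero_apply] at hj ⊢
      exact_mod_cast hj)
    rw [hXU]
    exact ⟨fun h => hvU (hclosed _ hvW (Or.inl h)), fun h => hvU (hclosed _ hvW (Or.inr h))⟩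
  /- (4) doubling and hull-to-core: a core automorphism fixing `c̄` and moving `ē` to `ē'` -/
  obtain ⟨e', hiso, hs', hgp⟩ := hD c e hXs hXes hXlin hXδ hfree
  obtain ⟨g, hg, hgce⟩ := hH2C hiso hXes hs'
  have hgc : ∀ i, g (c i) = c i := fun i => by
    have h := hgce (Fin.castAdd k i)
    rwa [Fin.append_left, Fin.append_left] at h
  have hge : ∀ j, g (e j) = e' j := fun j => by
    have h := hgce (Fin.natAdd (s.card + 1) j)
    rwa [Fin.append_right, Fin.append_right] at h
  /- (5) `g` is `ℚ`-linear on `ecl ∅ ⊇ W` and the identity on `U`; `g a = a` forces `a ∈ U` -/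
  have hg₂ : IsEIsoOn₂ g (ecl (∅ : Set ℂ)) (ecl (∅ : Set ℂ)) := isEIsoOn₂_iff_isEIsoOn.2 hg
  have hcecl : ∀ i, c i ∈ ecl (∅ : Set ℂ) := fun i => hWecl _ (hUW (hcU i))
  have heecl : ∀ j, e j ∈ ecl (∅ : Set ℂ) := fun j => hWecl _ (heW j)
  have hgU : ∀ u ∈ U, g u = u := by
    intro u hu
    obtain ⟨p, rfl⟩ := (Submodule.mem_span_range_iff_exists_fun ℚ).1 (hUc hu)
    rw [hg₂.map_sum_smul p hcecl]
    simp only [hgc]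
  obtain ⟨u, hu, w, hw, huw⟩ := Submodule.mem_sup.1 (show a ∈ U ⊔ Submodule.span ℚ (range e) by
    rw [hUe]; exact haW)
  obtain ⟨q, rfl⟩ := (Submodule.mem_span_range_iff_exists_fun ℚ).1 hw
  have hga : g a = u + ∑ j, q j • e' j := by
    rw [← huw, hg₂.map_add_sum_smul (hWecl u (hUW hu)) q heecl, hgU u hu]
    simp only [hge]
  have hq : q = 0 := by
    by_contra hq0
    refine hgp q hq0 ?_
    have h0 : ∑ j, q j • (e' j - e j) = 0 := by
      have h1 : u + ∑ j, q j • e' j = u + ∑ j, q j • e j := by rw [← hga, hfix g hg, huw]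
      simp only [smul_sub, Finset.sum_sub_distrib, sub_eq_zero]
      exact add_left_cancel h1
    rw [h0]
    exact Submodule.zero_mem _
  have haU : a ∈ U := by
    rw [← huw, hq]
    simp only [Pi.zero_apply, zero_smul, Finset.sum_const_zero, add_zero]
    exact hu
  exact IntermediateField.mem_sInf.2 fun K hK =>
    (IntermediateField.mem_toSubalgebra K a).1 ((Subalgebra.mem_toSubmodule _).1 (hGU K hK haU))

end Summit.Schanuel.Schanuel.Theorems.RigidCore
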